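import Mathlib
import Summits.MatrixMultiplication.MatrixMultiplication.Theses.HiddenToeplitzCorners
import Literature.Computability.AlgebraicComplexity.ArithCircuitProofs
import Literature.Computability.AlgebraicComplexity.MatMulTotalComplexityProofs
import Literature.Computability.AlgebraicComplexity.FastFourierTransform
import Literature.Computability.AlgebraicComplexity.DivisionSLP
import Literature.LinearAlgebra.Matrix.CauchyDeterminant
import Literature.LinearAlgebra.Matrix.CauchyLike
import Summits.MatrixMultiplication.MatrixMultiplication.Theorems.HiddenToeplitzCornersToeplitzLikeDetCostCauchyMatvec
import Summits.MatrixMultiplication.MatrixMultiplication.Theorems.HiddenToeplitzCornersToeplitzLikeDetCostFFTCost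

/-!
# Stub `stub_normalise` of crux `HiddenToeplitzCorners.ToeplitzLikeDetCost` (stmt-MatrixMultiplication-7491),
# line `Sketch`

The free-constant normalisation on the Cauchy grids (K-level); uses the landed `stub_cauchyMatvec` + `fftCost`.

Target tree file: `Summits/MatrixMultiplication/MatrixMultiplication/Theorems/HiddenToeplitzCornersToeplitzLikeDetCostNormalise.lean`
(helper for the crux, landed with `--supports stmt-MatrixMultiplication-7491`). The theorem `stub_normalise`
below must keep EXACTLY this name and signature (it is registered on the crux).
-/

set_option linter.dupNamespace false

namespace Summit.MatrixMultiplication.MatrixMultiplication.Theorems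

open scoped BigOperators Matrix
open Literature.Computability.AlgebraicComplexity Literature.LinearAlgebra.Matrix
open Literature.Computability.AlgebraicComplexity.ArithCircuit (FanInTwoSeq freeInputs)
open Summit.MatrixMultiplication.MatrixMultiplication.Theses.HiddenToeplitzCorners (ToeplitzLikeDetCost)

noncomputable section

/-- Nodes on two cosets `a⟨ω⟩`, `b⟨ω⟩` of a root of unity `ω` with `‖a‖ ≠ ‖b‖` never collide
(take norms, `‖ω‖ = 1`). [folklore] -/
theorem coset_nodes_ne {κ : ℕ} {ω : ℂ} (hω : IsPrimitiveRoot ω (2 ^ κ)) {a b : ℂ}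
    (hab : ‖a‖ ≠ ‖b‖) (i j : ℕ) : a * ω ^ i ≠ b * ω ^ j := by
  intro h
  have hn : ‖ω‖ = 1 := hω.norm'_eq_one (by positivity)
  have := congrArg norm h
  simp only [norm_mul, norm_pow, hn, one_pow, mul_one] at this
  exact hab this

/-- **Sylvester displacement of the inverse**: if `D_x B - B D_y = G Hᵀ` and `B` is invertible
then `D_y B⁻¹ - B⁻¹ D_x = -(B⁻¹ G) (Hᵀ B⁻¹)`. [folklore] -/
theorem displacement_inv {n p F : Type*} [Fintype n] [DecidableEq n] [Fintype p] [Field F]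
    {x y : n → F} {B : Matrix n n F} {G H : Matrix n p F}
    (hB : Matrix.diagonal x * B - B * Matrix.diagonal y = G * Hᵀ) (hdet : IsUnit B.det) :
    Matrix.diagonal y * B⁻¹ - B⁻¹ * Matrix.diagonal x = -(B⁻¹ * G * (Hᵀ * B⁻¹)) := by
  have h1 : B⁻¹ * B = 1 := Matrix.nonsing_inv_mul B hdet
  have h2 : B * B⁻¹ = 1 := Matrix.mul_nonsing_inv B hdet
  have e1 : B⁻¹ * (Matrix.diagonal x * B) * B⁻¹ = B⁻¹ * Matrix.diagonal x := by
    rw [Matrix.mul_assoc, Matrix.mul_assoc, h2, Matrix.mul_one]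
  have e2 : B⁻¹ * (B * Matrix.diagonal y) * B⁻¹ = Matrix.diagonal y * B⁻¹ := by
    rw [← Matrix.mul_assoc B⁻¹ B, h1, Matrix.one_mul]
  have key : B⁻¹ * (G * Hᵀ) * B⁻¹ = B⁻¹ * Matrix.diagonal x - Matrix.diagonal y * B⁻¹ := by
    rw [← hB, Matrix.mul_sub, Matrix.sub_mul, e1, e2]
  rw [← neg_sub (B⁻¹ * Matrix.diagonal x), ← key]
  simp only [Matrix.mul_assoc]

/-- **Displacement of the normaliser** `W = K' B⁻¹` (`K'` the plain Cauchy matrix on the nodes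
`z, y` with the all-ones generator `O`, `B` Cauchy-like on `x, y`):
`D_z W - W D_x = (D_z K' - K' D_y) B⁻¹ + K' (D_y B⁻¹ - B⁻¹ D_x)`, a generator of length
`1 + α`. [folklore] -/
theorem displacement_normaliser {n p F : Type*} [Fintype n] [DecidableEq n] [Fintype p]
    [Field F] (x y z : n → F) (hzy : ∀ i j, z i ≠ y j) (O : Matrix n (Fin 1) F) {B : Matrix n n F}
    {G H : Matrix n p F} (hB : Matrix.diagonal x * B - B * Matrix.diagonal y = G * Hᵀ)
    (hdet : IsUnit B.det) :
    Matrix.diagonal z * (cauchyLike z y O O * B⁻¹) -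
        cauchyLike z y O O * B⁻¹ * Matrix.diagonal x =
      Matrix.fromCols O (cauchyLike z y O O * (-(B⁻¹ * G))) *
        (Matrix.fromCols (B⁻¹ᵀ * O) ((Hᵀ * B⁻¹)ᵀ))ᵀ := by
  set K' := cauchyLike z y O O with hK'
  have hK : Matrix.diagonal z * K' - K' * Matrix.diagonal y = O * Oᵀ :=
    diagonal_mul_cauchyLike_sub z y O O hzy
  have hinv := displacement_inv hB hdet
  have hsplit : Matrix.diagonal z * (K' * B⁻¹) - K' * B⁻¹ * Matrix.diagonal x =
      (Matrix.diagonal z * K' - K' * Matrix.diagonal y) * B⁻¹ +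
        K' * (Matrix.diagonal y * B⁻¹ - B⁻¹ * Matrix.diagonal x) := by
    rw [Matrix.sub_mul, Matrix.mul_sub]
    simp only [Matrix.mul_assoc]
    abel
  rw [hsplit, hK, hinv]
  simp only [Matrix.transpose_fromCols, Matrix.fromCols_mul_fromRows, Matrix.transpose_mul,
    Matrix.transpose_transpose, Matrix.mul_neg, Matrix.neg_mul, Matrix.mul_assoc]

/-- A Sylvester displacement equation is preserved by a ring homomorphism of the entries.
[folklore] -/
theorem displacement_map {n p q F F' : Type*} [Fintype n] [DecidableEq n] [Fintype q] [Field F]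
    [Field F'] (f : F →+* F') {x : n → F} {z : p → F} {W : Matrix p n F} {G : Matrix p q F}
    {H : Matrix n q F} [Fintype p] [DecidableEq p]
    (hW : Matrix.diagonal z * W - W * Matrix.diagonal x = G * Hᵀ) :
    Matrix.diagonal (fun i => f (z i)) * W.map f - W.map f * Matrix.diagonal (fun i => f (x i)) =
      G.map f * (H.map f)ᵀ := by
  have h := congrArg (fun M : Matrix p n F => M.map f) hW
  rw [Matrix.map_sub _ (map_sub f), Matrix.map_mul, Matrix.map_mul, Matrix.map_mul,
    Matrix.diagonal_map (map_zero f), Matrix.diagonal_map (map_zero f), Matrix.transpose_map] at h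
  exact h

/-- **Product rule for the Sylvester displacement**:
`D_z (W C) - (W C) D_y = (D_z W - W D_x) C + W (D_x C - C D_y)`; generators concatenate.
[folklore] -/
theorem displacement_mul {m n o p q F : Type*} [Fintype m] [DecidableEq m] [Fintype n]
    [DecidableEq n] [Fintype o] [DecidableEq o] [Fintype p] [Fintype q] [Field F]
    {x : n → F} {y : o → F} {z : m → F} {W : Matrix m n F} {C : Matrix n o F}
    {GW : Matrix m q F} {HW : Matrix n q F} {G : Matrix n p F} {H : Matrix o p F}
    (hW : Matrix.diagonal z * W - W * Matrix.diagonal x = GW * HWᵀ)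
    (hC : Matrix.diagonal x * C - C * Matrix.diagonal y = G * Hᵀ) :
    Matrix.diagonal z * (W * C) - W * C * Matrix.diagonal y =
      Matrix.fromCols GW (W * G) * (Matrix.fromCols (Cᵀ * HW) H)ᵀ := by
  have hsplit : Matrix.diagonal z * (W * C) - W * C * Matrix.diagonal y =
      (Matrix.diagonal z * W - W * Matrix.diagonal x) * C +
        W * (Matrix.diagonal x * C - C * Matrix.diagonal y) := by
    rw [Matrix.sub_mul, Matrix.mul_sub]
    simp only [Matrix.mul_assoc]
    abel
  rw [hsplit, hW, hC]
  simp only [Matrix.transpose_fromCols, Matrix.fromCols_mul_fromRows, Matrix.transpose_mul,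
    Matrix.transpose_transpose, Matrix.mul_assoc]

section KLevel2
variable {K : Type} [Field K] [Algebra ℂ K]

/-- **Cost of the normalised generator** `(G_C, H_C)`: the first block of `G_C` is constant, the
second block is `card p₃` products of the constant Cauchy-like matrix `W` (cosets `3⟨ω⟩, ⟨ω⟩`,
generator length `card p₃ + 1`) with the columns of `G₃`; the first block of `H_C` is
`card p₃ + 1` products of constant rows with `C₀` (cosets `⟨ω⟩, 2⟨ω⟩`, generator `(G₃, H₃)`), the
second block is `H₃` itself. With the matvec engine `hmv` this is
`2 · card p₃ · (card p₃ + 1) · (2κ + 7) · 2^κ` steps. [folklore] -/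
theorem normalise_cost
    (hmv : ∀ (κ : ℕ) (ω a b : ℂ), IsPrimitiveRoot ω (2 ^ κ) → a ≠ 0 → b ≠ 0 →
      (∀ i j : ℕ, a * ω ^ i ≠ b * ω ^ j) →
      ∀ (p : Type) [Fintype p] [DecidableEq p] (G H : Matrix (Fin (2 ^ κ)) p K)
        (v : Fin (2 ^ κ) → K) (A : Set K),
      (∀ i k, G i k ∈ A ∪ Set.range (algebraMap ℂ K)) →
      (∀ i k, H i k ∈ A ∪ Set.range (algebraMap ℂ K)) →
      (∀ i, v i ∈ A ∪ Set.range (algebraMap ℂ K)) →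
      Derivable ℂ (Fintype.card p * (2 * κ + 7) * 2 ^ κ) A
          (Set.range ((cauchyLike (fun i : Fin (2 ^ κ) => algebraMap ℂ K (a * ω ^ (i : ℕ)))
            (fun j : Fin (2 ^ κ) => algebraMap ℂ K (b * ω ^ (j : ℕ))) G H).mulVec v)) ∧
        Derivable ℂ (Fintype.card p * (2 * κ + 7) * 2 ^ κ) A
          (Set.range (Matrix.vecMul v (cauchyLike
            (fun i : Fin (2 ^ κ) => algebraMap ℂ K (a * ω ^ (i : ℕ)))
            (fun j : Fin (2 ^ κ) => algebraMap ℂ K (b * ω ^ (j : ℕ))) G H))))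
    {κ : ℕ} {ω : ℂ} (hω : IsPrimitiveRoot ω (2 ^ κ)) {p₃ : Type} [Fintype p₃] [DecidableEq p₃]
    (G₃ H₃ : Matrix (Fin (2 ^ κ)) p₃ K) {W' : Matrix (Fin (2 ^ κ)) (Fin (2 ^ κ)) K}
    {GW HW : Matrix (Fin (2 ^ κ)) (Fin 1 ⊕ p₃) ℂ}
    (hW' : W' = cauchyLike (fun i : Fin (2 ^ κ) => algebraMap ℂ K (3 * ω ^ (i : ℕ)))
      (fun j : Fin (2 ^ κ) => algebraMap ℂ K (1 * ω ^ (j : ℕ))) (GW.map (algebraMap ℂ K))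
      (HW.map (algebraMap ℂ K)))
    (A : Set K) (hG : ∀ i k, G₃ i k ∈ A ∪ Set.range (algebraMap ℂ K))
    (hH : ∀ i k, H₃ i k ∈ A ∪ Set.range (algebraMap ℂ K)) :
    Derivable ℂ (2 * Fintype.card p₃ * (Fintype.card p₃ + 1) * (2 * κ + 7) * 2 ^ κ) A
      (Set.range (fun ik : Fin (2 ^ κ) × ((Fin 1 ⊕ p₃) ⊕ p₃) =>
          (Matrix.fromCols (GW.map (algebraMap ℂ K)) (W' * G₃)) ik.1 ik.2) ∪
        Set.range (fun ik : Fin (2 ^ κ) × ((Fin 1 ⊕ p₃) ⊕ p₃) =>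
          (Matrix.fromCols ((cauchyLike (fun i : Fin (2 ^ κ) => algebraMap ℂ K (1 * ω ^ (i : ℕ)))
            (fun j : Fin (2 ^ κ) => algebraMap ℂ K (2 * ω ^ (j : ℕ))) G₃ H₃)ᵀ *
            (HW.map (algebraMap ℂ K))) H₃) ik.1 ik.2)) := by
  have h31 : ‖(3 : ℂ)‖ ≠ ‖(1 : ℂ)‖ := by norm_num
  have h12 : ‖(1 : ℂ)‖ ≠ ‖(2 : ℂ)‖ := by norm_num
  have hGW : ∀ i l, GW.map (algebraMap ℂ K) i l ∈ A ∪ Set.range (algebraMap ℂ K) :=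
    fun i l => Or.inr ⟨GW i l, rfl⟩
  have hHW : ∀ i l, HW.map (algebraMap ℂ K) i l ∈ A ∪ Set.range (algebraMap ℂ K) :=
    fun i l => Or.inr ⟨HW i l, rfl⟩
  -- (1) the `card p₃` products `W' * (column k of G₃)`
  have h1 : ∀ k : p₃, Derivable ℂ (Fintype.card (Fin 1 ⊕ p₃) * (2 * κ + 7) * 2 ^ κ) A
      (Set.range (W'.mulVec fun j => G₃ j k)) := by
    intro k
    rw [hW']
    exact (hmv κ ω 3 1 hω three_ne_zero one_ne_zero (coset_nodes_ne hω h31) (Fin 1 ⊕ p₃)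
      (GW.map (algebraMap ℂ K)) (HW.map (algebraMap ℂ K)) (fun j => G₃ j k) A hGW hHW
      (fun j => hG j k)).1
  -- (2) the `card p₃ + 1` products `(column c of H_W) * C₀`
  have h2 : ∀ c : Fin 1 ⊕ p₃, Derivable ℂ (Fintype.card p₃ * (2 * κ + 7) * 2 ^ κ) A
      (Set.range (Matrix.vecMul (fun i => HW.map (algebraMap ℂ K) i c)
        (cauchyLike (fun i : Fin (2 ^ κ) => algebraMap ℂ K (1 * ω ^ (i : ℕ)))
          (fun j : Fin (2 ^ κ) => algebraMap ℂ K (2 * ω ^ (j : ℕ))) G₃ H₃))) := by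
    intro c
    exact (hmv κ ω 1 2 hω one_ne_zero two_ne_zero (coset_nodes_ne hω h12) p₃ G₃ H₃
      (fun i => HW.map (algebraMap ℂ K) i c) A hG hH (fun i => hHW i c)).2
  have hU1 := Derivable.biUnion (Finset.univ : Finset p₃) (fun k _ => h1 k)
  have hU2 := Derivable.biUnion (Finset.univ : Finset (Fin 1 ⊕ p₃)) (fun c _ => h2 c)
  have hU0 : Derivable ℂ 0 A (A ∪ Set.range (algebraMap ℂ K)) :=
    Derivable.of_subset subset_rfl 0
  refine ((hU0.union hU1).union hU2).mono ?_ le_rfl ?_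
  · simp only [Finset.sum_const, Finset.card_univ, Fintype.card_sum, Fintype.card_fin,
      smul_eq_mul]
    exact le_of_eq (by ring)
  · rintro v (⟨⟨i, l | k⟩, rfl⟩ | ⟨⟨j, c | k⟩, rfl⟩)
    · -- a constant entry of `G_W`
      refine Or.inl (Or.inl (Or.inr ⟨GW i l, ?_⟩))
      simp [Matrix.fromCols_apply_inl]
    · -- an entry of `W' * G₃`
      refine Or.inl (Or.inr (Set.mem_biUnion (Finset.mem_coe.2 (Finset.mem_univ k)) ⟨i, ?_⟩))
      simp only [Matrix.fromCols_apply_inr, Matrix.mul_apply, Matrix.mulVec, dotProduct]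
    · -- an entry of `C₀ᵀ * H_W`
      refine Or.inr (Set.mem_biUnion (Finset.mem_coe.2 (Finset.mem_univ c)) ⟨j, ?_⟩)
      simp only [Matrix.fromCols_apply_inl, Matrix.mul_apply, Matrix.vecMul, dotProduct,
        Matrix.transpose_apply]
      exact Finset.sum_congr rfl fun i _ => mul_comm _ _
    · -- an entry of `H₃`
      refine Or.inl (Or.inl ?_)
      simpa [Matrix.fromCols_apply_inr] using hH j k

/-- **Stub `normalise`** — see `Lines/Sketch.lean`. [folklore] -/
theorem stub_normalise :
    ∀ (κ : ℕ) (ω : ℂ), IsPrimitiveRoot ω (2 ^ κ) →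
      ∀ (p₃ : Type) [Fintype p₃] [DecidableEq p₃] (G₃ H₃ : Matrix (Fin (2 ^ κ)) p₃ K)
        (B₀ : Matrix (Fin (2 ^ κ)) (Fin (2 ^ κ)) ℂ) (G₃₀ H₃₀ : Matrix (Fin (2 ^ κ)) p₃ ℂ),
      B₀ = cauchyLike (fun i : Fin (2 ^ κ) => (1 : ℂ) * ω ^ (i : ℕ)) (fun j : Fin (2 ^ κ) => (2 : ℂ) * ω ^ (j : ℕ)) G₃₀ H₃₀ → IsUnit B₀.det →
      ((cauchyLike (fun i : Fin (2 ^ κ) => (3 : ℂ) * ω ^ (i : ℕ)) (fun j : Fin (2 ^ κ) => (2 : ℂ) * ω ^ (j : ℕ)) (Matrix.of fun (_ : Fin (2 ^ κ)) (_ : Fin 1) => (1 : ℂ)) (Matrix.of fun (_ : Fin (2 ^ κ)) (_ : Fin 1) => (1 : ℂ))) * B₀⁻¹).map (algebraMap ℂ K) * (cauchyLike (fun i : Fin (2 ^ κ) => algebraMap ℂ K (1 * ω ^ (i : ℕ))) (fun j : Fin (2 ^ κ) => algebraMap ℂ K (2 * ω ^ (j : ℕ))) G₃ H₃) =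
          cauchyLike (fun i : Fin (2 ^ κ) => algebraMap ℂ K (3 * ω ^ (i : ℕ))) (fun j : Fin (2 ^ κ) => algebraMap ℂ K (2 * ω ^ (j : ℕ)))
            (Matrix.fromCols ((Matrix.fromCols (Matrix.of fun (_ : Fin (2 ^ κ)) (_ : Fin 1) => (1 : ℂ)) ((cauchyLike (fun i : Fin (2 ^ κ) => (3 : ℂ) * ω ^ (i : ℕ)) (fun j : Fin (2 ^ κ) => (2 : ℂ) * ω ^ (j : ℕ)) (Matrix.of fun (_ : Fin (2 ^ κ)) (_ : Fin 1) => (1 : ℂ)) (Matrix.of fun (_ : Fin (2 ^ κ)) (_ : Fin 1) => (1 : ℂ))) * (-(B₀⁻¹ * G₃₀)))).map (algebraMap ℂ K)) (((cauchyLike (fun i : Fin (2 ^ κ) => (3 : ℂ) * ω ^ (i : ℕ)) (fun j : Fin (2 ^ κ) => (2 : ℂ) * ω ^ (j : ℕ)) (Matrix.of fun (_ : Fin (2 ^ κ)) (_ : Fin 1) => (1 : ℂ)) (Matrix.of fun (_ : Fin (2 ^ κ)) (_ : Fin 1) => (1 : ℂ))) * B₀⁻¹).map (algebraMap ℂ K)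 * G₃))
            (Matrix.fromCols ((cauchyLike (fun i : Fin (2 ^ κ) => algebraMap ℂ K (1 * ω ^ (i : ℕ))) (fun j : Fin (2 ^ κ) => algebraMap ℂ K (2 * ω ^ (j : ℕ))) G₃ H₃)ᵀ * (Matrix.fromCols (B₀⁻¹ᵀ * (Matrix.of fun (_ : Fin (2 ^ κ)) (_ : Fin 1) => (1 : ℂ))) ((H₃₀ᵀ * B₀⁻¹)ᵀ)).map (algebraMap ℂ K)) H₃) ∧
      ∀ (A : Set K), (∀ i k, G₃ i k ∈ A ∪ Set.range (algebraMap ℂ K)) →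
        (∀ i k, H₃ i k ∈ A ∪ Set.range (algebraMap ℂ K)) →
        Derivable ℂ (2 * Fintype.card p₃ * (Fintype.card p₃ + 1) * (2 * κ + 7) * 2 ^ κ) A
          (Set.range (fun ik : Fin (2 ^ κ) × ((Fin 1 ⊕ p₃) ⊕ p₃) =>
              (Matrix.fromCols ((Matrix.fromCols (Matrix.of fun (_ : Fin (2 ^ κ)) (_ : Fin 1) => (1 : ℂ)) ((cauchyLike (fun i : Fin (2 ^ κ) => (3 : ℂ) * ω ^ (i : ℕ)) (fun j : Fin (2 ^ κ) => (2 : ℂ) * ω ^ (j : ℕ)) (Matrix.of fun (_ : Fin (2 ^ κ)) (_ : Fin 1) => (1 : ℂ)) (Matrix.of fun (_ : Fin (2 ^ κ)) (_ : Fin 1) => (1 : ℂ))) * (-(B₀⁻¹ * G₃₀)))).map (algebraMap ℂ K)) (((cauchyLike (fun i : Fin (2 ^ κ) => (3 : ℂ) * ω ^ (i : ℕ)) (fun j : Fin (2 ^ κ) => (2 : ℂ) * ω ^ (j : ℕ)) (Matrix.of fun (_ : Fin (2 ^ κ)) (_ : Fin 1) => (1 : ℂ)) (Matrix.of fun (_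 : Fin (2 ^ κ)) (_ : Fin 1) => (1 : ℂ))) * B₀⁻¹).map (algebraMap ℂ K) * G₃)) ik.1 ik.2) ∪
           Set.range (fun ik : Fin (2 ^ κ) × ((Fin 1 ⊕ p₃) ⊕ p₃) =>
              (Matrix.fromCols ((cauchyLike (fun i : Fin (2 ^ κ) => algebraMap ℂ K (1 * ω ^ (i : ℕ))) (fun j : Fin (2 ^ κ) => algebraMap ℂ K (2 * ω ^ (j : ℕ))) G₃ H₃)ᵀ * (Matrix.fromCols (B₀⁻¹ᵀ * (Matrix.of fun (_ : Fin (2 ^ κ)) (_ : Fin 1) => (1 : ℂ))) ((H₃₀ᵀ * B₀⁻¹)ᵀ)).map (algebraMap ℂ K)) H₃) ik.1 ik.2)) := by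
  have hmv := stub_cauchyMatvec (K := K) (fftCost (K := K))
  intro κ ω hω p₃ _ _ G₃ H₃ B₀ G₃₀ H₃₀ hB hdet
  -- the three coset pairs never collide (norms `3 ≠ 2`, `1 ≠ 2`, `3 ≠ 1`)
  have h32 : ‖(3 : ℂ)‖ ≠ ‖(2 : ℂ)‖ := by norm_num
  have h12 : ‖(1 : ℂ)‖ ≠ ‖(2 : ℂ)‖ := by norm_num
  have h31 : ‖(3 : ℂ)‖ ≠ ‖(1 : ℂ)‖ := by norm_num
  have hzyc : ∀ i j : Fin (2 ^ κ), (3 : ℂ) * ω ^ (i : ℕ) ≠ 2 * ω ^ (j : ℕ) := fun i j =>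
    coset_nodes_ne hω h32 i j
  have hxyc : ∀ i j : Fin (2 ^ κ), (1 : ℂ) * ω ^ (i : ℕ) ≠ 2 * ω ^ (j : ℕ) := fun i j =>
    coset_nodes_ne hω h12 i j
  have hinj := (algebraMap ℂ K).injective
  have hzys : ∀ i j : Fin (2 ^ κ),
      algebraMap ℂ K (3 * ω ^ (i : ℕ)) ≠ algebraMap ℂ K (2 * ω ^ (j : ℕ)) := fun i j h =>
    coset_nodes_ne hω h32 i j (hinj h)
  have hxys : ∀ i j : Fin (2 ^ κ),
      algebraMap ℂ K (1 * ω ^ (i : ℕ)) ≠ algebraMap ℂ K (2 * ω ^ (j : ℕ)) := fun i j h =>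
    coset_nodes_ne hω h12 i j (hinj h)
  have hzxs : ∀ i j : Fin (2 ^ κ),
      algebraMap ℂ K (3 * ω ^ (i : ℕ)) ≠ algebraMap ℂ K (1 * ω ^ (j : ℕ)) := fun i j h =>
    coset_nodes_ne hω h31 i j (hinj h)
  -- displacement of `B₀`, of the normaliser `W` (over `ℂ`, then over `K`), of `C₀`, of `W C₀`
  have hB' : Matrix.diagonal (fun i : Fin (2 ^ κ) => (1 : ℂ) * ω ^ (i : ℕ)) * B₀ -
      B₀ * Matrix.diagonal (fun j : Fin (2 ^ κ) => (2 : ℂ) * ω ^ (j : ℕ)) = G₃₀ * H₃₀ᵀ := by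
    rw [hB]
    exact diagonal_mul_cauchyLike_sub _ _ _ _ hxyc
  have hWc := displacement_normaliser _ _ (fun i : Fin (2 ^ κ) => (3 : ℂ) * ω ^ (i : ℕ)) hzyc
    (Matrix.of fun (_ : Fin (2 ^ κ)) (_ : Fin 1) => (1 : ℂ)) hB' hdet
  have hWK := displacement_map (algebraMap ℂ K) hWc
  have hC0 := diagonal_mul_cauchyLike_sub
    (fun i : Fin (2 ^ κ) => algebraMap ℂ K (1 * ω ^ (i : ℕ)))
    (fun j : Fin (2 ^ κ) => algebraMap ℂ K (2 * ω ^ (j : ℕ))) G₃ H₃ hxys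
  have hprod := displacement_mul hWK hC0
  exact ⟨eq_cauchyLike_of_displacement hzys hprod, fun A hG hH =>
    normalise_cost hmv hω G₃ H₃ (eq_cauchyLike_of_displacement hzxs hWK) A hG hH⟩

end KLevel2

end

end Summit.MatrixMultiplication.MatrixMultiplication.Theorems
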